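import Literature.Geometry.Kaehler.RiemannSurfaceClosedChainLogDerivative
import Literature.Geometry.Kaehler.RiemannSurfaceLogDerivativePeriods
import Literature.Geometry.Kaehler.RiemannSurfaceAbelTheorem
import Literature.NumberTheory.Transcendental.ComplexFormsProofs
import Literature.NumberTheory.Transcendental.ComplexDeRhamRealStructure
import HarnessLib

/-!
# The period pairing: every loop `γ` has a holomorphic differential `η_γ` with
# `∬ θ ∧ η̄_γ = const · ∫_γ θ` for all `θ ∈ Ω(M)` and `2 Re ∫_δ η_γ ∈ ℤ` for all loops `δ`
# (Forster §20.5–21.7; Lange–Birkenhake §11.1; the analytic input of the Riemann form of `Jac(M)`)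

Layer `Literature/Geometry/Kaehler`, sequel of `RiemannSurfaceClosedChainLogDerivative` (for a
closed chain `c`: the corrected weak solution `u = closedChainUnit c`, nowhere zero and smooth, and
`θ dz ∧ (2πi)⁻¹ v⁻¹ dv + (2πi)⁻¹ θ dz ∧ d log|u| = θ dz ∧ σ_c` for `v = u/|u|`),
`RiemannSurfaceLogDerivativePeriods` (periods of the Hodge components of a logarithmic differential:
`2 Re ∫_δ θ ∈ ℤ`), `RiemannSurfaceAbelTheorem` (every loop `γ` at `x₀` is the boundary-free chain
`reach x̃₀ (γ⁻¹ · x̃₀)` with periods `∫_γ`), `RiemannSurfaceAbelTheoremChains` (Lemma 20.5: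
`∬ θ dz ∧ σ_c = -(C/2) ∫_c θ`) and `RiemannSurfaceHodgeDecompositionH1` (19.12:
`β = ω₁ dz + ω̄₂ dz̄ + dΨ`).

For a compact connected Riemann surface `M` and a loop `γ` at `x₀`:

* §1 the complex surface integral `cintegral` of `Literature.AlgebraicGeometry.Motives` on smooth
  complex `2`-forms of `M` (additivity, vanishing on exact forms — Stokes), and the **pairing**
  `holPairing θ ω = ∬_M θ dz ∧ ω̄ dz̄` of two differentials (Forster §19.5's `⟨ω₁, ω₂⟩` up to the
  factor `i/2`, kept out to stay in the tree's `oneZeroForm ∧ zeroOneForm` vocabulary);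
* §2 **`exists_holomorphicOneForm_holPairing_eq_period`**: there is `η ∈ Ω(M)` with
  `holPairing θ η = -(C/2) ∫_γ θ` for every `θ ∈ Ω(M)` (`C = chartIntegralConst`, the tree's
  normalisation `∬ dz ∧ dz̄`-integrals, Lemma 20.5) **and** `2 Re ∫_δ η ∈ ℤ` for every loop `δ`.
  Proof (Forster §20.5–§21.7 «the period lattice is the lattice of a Riemann form» assembled from the
  tree): `v = u/|u|` for the corrected weak solution `u` of the closed chain of `γ` is smooth with
  `|v| = 1`; its logarithmic differential `β = (2πi)⁻¹ v⁻¹ dv` is a smooth closed REAL `1`-form, so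
  its de Rham–Hodge decomposition `β = ω₁ dz + ω̄₂ dz̄ + dΨ` (19.12) has `ω₁ = ω₂ =: η` (conjugate and
  compare, uniqueness of the holomorphic parts); the periods of `β` are winding numbers, whence
  `∫_δ η + conj ∫_δ η ∈ ℤ` (`exists_int_two_mul_re_period_eq`); and for `θ ∈ Ω(M)`,
  `∬ θ ∧ β = ∬ θ ∧ η̄ dz̄ = holPairing θ η` (`θ ∧ ω₁ dz = 0`, `θ ∧ dΨ` exact) while
  `∬ θ ∧ β = ∬ θ ∧ σ_c = -(C/2) ∫_γ θ` (the correction `θ ∧ d log|u|` is exact; Lemma 20.5).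

Everything is proved; no named facts, no instances.

## References

* O. Forster, *Lectures on Riemann Surfaces*, GTM 81, Springer (1981), §19.5, §19.12, Lemma 20.5,
  Theorem 20.7, §21.7. [Forster1981]
* H. Lange, *Abelian Varieties over the Complex Numbers*, Springer (2023), §4.1.2 Proposition 4.1.2
  (the canonical polarization of the Jacobian, `E(λ_i, λ_j) = -(λ_i · λ_j)`). [Lange2023AbelianVarietiesComplex]
* R. Miranda, *Algebraic Curves and Riemann Surfaces*, GSM 5 (1995), Chapter VIII §1–§4. [Miranda1995]
-/

noncomputable section

open scoped Manifold ContDiff Topology ComplexConjugate Real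
open Set Filter Function Complex Metric
open Literature.NumberTheory.Transcendental Literature.Analysis.Complex Literature.Topology.CoveringSpaces
open Literature.AlgebraicGeometry.Motives (cintegral re_cintegral im_cintegral)

namespace Literature.Geometry.Kaehler

namespace RiemannSurface

open MeromorphicOneForm

universe u

variable {M : Type u} [TopologicalSpace M] [ChartedSpace ℂ M]

/-! ### §1 The complex surface integral and the pairing of differentials -/

section Integral

variable [IsManifold 𝓘(ℂ, ℂ) ω M] [IsManifold 𝓘(ℝ, ℂ) ∞ M] [CompactSpace M] [T2Space M]
  [Fact (Module.finrank ℝ ℂ = 2)]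

omit [CompactSpace M] [T2Space M] in
/-- The orientation of a Riemann surface is continuous (constant `Complex.orientation`).
[cite: Forster1981, §19.5] -/
theorem isContinuousOrientation_complex :
    IsContinuousOrientation (I := 𝓘(ℝ, ℂ)) (M := M) (fun _ ↦ Complex.orientation) :=
  Literature.AlgebraicGeometry.HodgeTheory.isContinuousOrientation_const _

/-- Additivity of `∬` on smooth complex `2`-forms. [cite: Forster1981, §19.5] -/
theorem cintegral_add_of_isSmoothForm {α β : MForm 𝓘(ℝ, ℂ) M ℂ 2} (hα : IsSmoothForm α)
    (hβ : IsSmoothForm β) :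
    cintegral (fun _ : M ↦ Complex.orientation) (α + β) =
      cintegral (fun _ : M ↦ Complex.orientation) α + cintegral (fun _ : M ↦ Complex.orientation) β := by
  have ho := isContinuousOrientation_complex (M := M)
  apply Complex.ext
  · rw [re_cintegral, Complex.add_re, re_cintegral, re_cintegral, MForm.re_add,
      MForm.integral_add_holds (o := fun _ : M ↦ Complex.orientation) ho hα.re hβ.re]
  · rw [im_cintegral, Complex.add_im, im_cintegral, im_cintegral, MForm.im_add,
      MForm.integral_add_holds (o := fun _ : M ↦ Complex.orientation) ho hα.im hβ.im]

/-- **Stokes**: an exact smooth complex `2`-form integrates to zero. [cite: Forster1981, Theorem 10.20 (Stokes) and §19.5] -/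
theorem cintegral_eq_zero_of_mem_cexactSmoothForms {α : MForm 𝓘(ℝ, ℂ) M ℂ 2}
    (hα : α ∈ cexactSmoothForms ℂ M 2) :
    cintegral (fun _ : M ↦ Complex.orientation) α = 0 := by
  have ho := isContinuousOrientation_complex (M := M)
  apply Complex.ext
  · rw [re_cintegral, Complex.zero_re]
    exact MForm.integral_eq_zero_of_mem_exactSmoothForms_holds (o := fun _ : M ↦ Complex.orientation) ho
      (re_mem_exactSmoothForms hα)
  · rw [im_cintegral, Complex.zero_im]
    exact MForm.integral_eq_zero_of_mem_exactSmoothForms_holds (o := fun _ : M ↦ Complex.orientation) ho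
      (im_mem_exactSmoothForms hα)

/-- **The pairing of two differentials**: `⟪θ, ω⟫ = ∬_M θ dz ∧ ω̄ dz̄` (Forster §19.5's scalar product
is `(i/2) ⟪ω₁, ω₂⟫` in this normalisation). [cite: Forster1981, §19.5] -/
def holPairing (θ ζ : MeromorphicOneForm M) : ℂ :=
  cintegral (fun _ : M ↦ Complex.orientation) ((oneZeroForm ⇑θ).wedge (zeroOneForm (star ⇑ζ)))

omit [IsManifold 𝓘(ℂ, ℂ) ω M] in
/-- Unfolding of `holPairing`. [cite: Forster1981, §19.5] -/
theorem holPairing_def (θ ζ : MeromorphicOneForm M) :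
    holPairing θ ζ =
      cintegral (fun _ : M ↦ Complex.orientation) ((oneZeroForm ⇑θ).wedge (zeroOneForm (star ⇑ζ))) := rfl

end Integral

/-! ### §2 The holomorphic differential of a loop -/

section Loop

variable [ConnectedSpace M] [IsManifold 𝓘(ℂ, ℂ) ω M] [IsManifold 𝓘(ℝ, ℂ) ∞ M] [CompactSpace M]
  [T2Space M] [Fact (Module.finrank ℝ ℂ = 2)] {x₀ : M}

omit [ConnectedSpace M] in
/-- **Lemma 20.5 as a complex number**: `∬ θ dz ∧ σ_c = -(C/2) · v(θ)` for a chain with periods `v`.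
[cite: Forster1981, Lemma 20.5] -/
theorem cintegral_wedge_chainForm {ι : Type*} [Fintype ι] {c : ι → ArcDatum M}
    {v : ↥(holomorphicOneForms M) → ℂ} (hp : ChainPeriods c v) (θ : ↥(holomorphicOneForms M)) :
    cintegral (fun _ : M ↦ Complex.orientation)
        ((oneZeroForm ⇑(θ : MeromorphicOneForm M)).wedge (chainForm c)) =
      -(chartIntegralConst / 2 : ℝ) * v θ := by
  obtain ⟨F, hF, hsum⟩ := hp.out θ
  apply Complex.ext
  · rw [re_cintegral, integral_re_wedge_chainForm c θ.2 hF, hsum]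
    simp [Complex.mul_re]
  · rw [im_cintegral, integral_im_wedge_chainForm c θ.2 hF, hsum]
    simp [Complex.mul_im]

/-- **The holomorphic differential of a loop.** For every loop `γ` at `x₀` on a compact connected
Riemann surface there is a holomorphic differential `η` with
`∬ θ dz ∧ η̄ dz̄ = -(C/2) ∫_γ θ` for all `θ ∈ Ω(M)` and `2 Re ∫_δ η ∈ ℤ` for all loops `δ`
(`η` is the common holomorphic part of the real closed form `(2πi)⁻¹ v⁻¹ dv`, `v = u/|u|` the
unitised weak solution of the closed chain of `γ`; Forster §20.5/§21.7, Lange Prop. 4.1.2).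
[cite: Forster1981, Lemma 20.5, §19.12 and §21.7] [cite: Lange2023AbelianVarietiesComplex, §4.1.2 Proposition 4.1.2] -/
theorem exists_holomorphicOneForm_holPairing_eq_period (γ : FundamentalGroup M x₀) :
    ∃ η : ↥(holomorphicOneForms M),
      (∀ θ : ↥(holomorphicOneForms M),
        holPairing (θ : MeromorphicOneForm M) (η : MeromorphicOneForm M) =
          -(chartIntegralConst / 2 : ℝ) * period x₀ (θ : MeromorphicOneForm M) γ) ∧
      ∀ δ : FundamentalGroup M x₀, ∃ n : ℤ, 2 * (period x₀ (η : MeromorphicOneForm M) δ).re = n := by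
  classical
  haveI : WedgeFacts 𝓘(ℝ, ℂ) M ℂ := wedgeFacts_of_comm (ContinuousAlternatingMap.WedgeComm_holds ℝ ℂ ℂ)
  -- Step 1: the closed chain of `γ`
  obtain ⟨ι, hι, c, hd, hp⟩ :=
    (reach (UniversalCover.base M x₀) (γ⁻¹ • UniversalCover.base M x₀)).out
  have hd0 : chainDivisor c = 0 := by
    rw [hd, UniversalCover.proj_smul]; exact sub_self _
  have hper : ChainPeriods c (fun θ ↦ period x₀ (θ : MeromorphicOneForm M) γ) :=
    hp.congr fun θ ↦ by rw [period_def, development_base, sub_zero]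
  -- Step 2: the unitised corrected weak solution `v` and its logarithmic differential
  set u : M → ℂ := closedChainUnit c with hu
  have hu0 : ∀ x, u x ≠ 0 := closedChainUnit_ne_zero c
  have huC : ∀ x, ContDiffAt ℝ ∞ (u ∘ (chartAt ℂ x).symm) (chartAt ℂ x x) :=
    contDiffAt_closedChainUnit c hd0
  set v : M → ℂ := unitize u with hv
  have hv1 : ∀ x, ‖v x‖ = 1 := norm_unitize hu0
  have hv0 : ∀ x, v x ≠ 0 := unitize_ne_zero hu0
  have hvC : ∀ x, ContDiffAt ℝ ∞ (v ∘ (chartAt ℂ x).symm) (chartAt ℂ x x) := contDiffAt_unitize huC hu0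
  have hvD : ∀ x, DifferentiableAt ℝ (v ∘ (chartAt ℂ x).symm) (chartAt ℂ x x) := fun x ↦
    (hvC x).differentiableAt (by simp)
  have hβ : logDerivForm v ∈ cclosedSmoothForms ℂ M 1 := logDerivForm_mem_cclosedSmoothForms hvC hv0
  -- Step 3: Hodge decomposition, reality, `ω₁ = ω₂`
  obtain ⟨θ₁, θ₂, Ψ, hΨ, hdec⟩ := exists_eq_oneZeroForm_add_zeroOneForm_add_mextDeriv hβ
  have hconj : (logDerivForm v).conj = logDerivForm v := conj_logDerivForm_of_norm_eq_one hv1 hvD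
  have hΨc : IsSmoothForm Ψ.conj := isSmoothForm_conj hΨ
  have hdec' : logDerivForm v = oneZeroForm ⇑(θ₂ : MeromorphicOneForm M) +
      zeroOneForm (star ⇑(θ₁ : MeromorphicOneForm M)) + mextDeriv Ψ.conj := by
    have h := congrArg MForm.conj hdec
    rw [hconj, MForm.conj_add, MForm.conj_add, conj_oneZeroForm, conj_zeroOneForm, star_star,
      ← mextDeriv_conj_holds] at h
    rw [h]; abel
  have h12 : θ₁ = θ₂ := (oneZeroForm_add_zeroOneForm_add_mextDeriv_unique hΨ hΨc (hdec.symm.trans hdec')).1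
  -- Step 4: the function `ψ` of the `0`-form `Ψ` and the hypothesis of the period computation
  set ψ : M → ℂ := fun y ↦ Ψ y ![] with hψ
  have hΨeq : Ψ = MForm.ofFun 𝓘(ℝ, ℂ) ψ := (MForm.ofFun_apply_vecEmpty Ψ).symm
  have hψD : ∀ x, DifferentiableAt ℝ (ψ ∘ (chartAt ℂ x).symm) (chartAt ℂ x x) := by
    intro x
    have h1 := (isSmoothForm_iff_smoothAt _).1 (hΨeq ▸ hΨ) x
    rw [MForm.smoothAt_ofFun_iff, ModelWithCorners.Boundaryless.range_eq_univ, contDiffWithinAt_univ] at h1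
    have h2 : ψ ∘ (extChartAt 𝓘(ℝ, ℂ) x).symm = ψ ∘ (chartAt ℂ x).symm := by funext y; simp
    have h3 : extChartAt 𝓘(ℝ, ℂ) x x = chartAt ℂ x x := by simp
    rw [h2, h3] at h1
    exact h1.differentiableAt (by simp)
  have hyp : ∀ x (w : ℂ), fderiv ℝ (v ∘ (chartAt ℂ x).symm) (chartAt ℂ x x) w =
      2 * π * I * v x * ((θ₂ : MeromorphicOneForm M) x * w + conj ((θ₂ : MeromorphicOneForm M) x * w) +
        fderiv ℝ (ψ ∘ (chartAt ℂ x).symm) (chartAt ℂ x x) w) := by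
    intro x w
    have e1 := congrArg (fun β : MForm 𝓘(ℝ, ℂ) M ℂ 1 ↦ β x (fun _ ↦ (w : TangentSpace 𝓘(ℝ, ℂ) x))) hdec
    rw [logDerivForm_apply, h12, hΨeq, Pi.add_apply, Pi.add_apply, ContinuousAlternatingMap.add_apply,
      ContinuousAlternatingMap.add_apply, oneZeroForm_apply, zeroOneForm_apply,
      mextDeriv_ofFun_apply'] at e1
    have h2 : ψ ∘ (extChartAt 𝓘(ℝ, ℂ) x).symm = ψ ∘ (chartAt ℂ x).symm := by funext y; simp
    have h3 : extChartAt 𝓘(ℝ, ℂ) x x = chartAt ℂ x x := by simp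
    rw [h2, h3] at e1
    have h2pi : (2 * π * I : ℂ) ≠ 0 := by
      have : (π : ℂ) ≠ 0 := by exact_mod_cast Real.pi_ne_zero
      simp [this, I_ne_zero]
    have hvx : v x ≠ 0 := hv0 x
    have hD : fderiv ℝ (v ∘ (chartAt ℂ x).symm) (chartAt ℂ x x) w =
        2 * π * I * v x * ((2 * π * I)⁻¹ * ((v x)⁻¹ * fderiv ℝ (v ∘ (chartAt ℂ x).symm) (chartAt ℂ x x) w)) := by
      field_simp
    rw [hD, e1, Pi.star_apply, RCLike.star_def, map_mul]
  -- Step 5: the periods of `η = ω₂`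
  refine ⟨θ₂, fun θ ↦ ?_, fun δ ↦ exists_int_two_mul_re_period_eq θ₂.2 hv0 hvD hψD hyp δ⟩
  -- Step 6: the pairing, computed twice
  have hθ : (θ : MeromorphicOneForm M).IsHolomorphic := θ.2
  have hη : (θ₂ : MeromorphicOneForm M).IsHolomorphic := θ₂.2
  have hs1 : IsSmoothForm (oneZeroForm ⇑(θ : MeromorphicOneForm M)) := hθ.isSmoothForm_oneZeroForm
  have hsβ : IsSmoothForm (logDerivForm v) := isSmoothForm_logDerivForm hvC hv0
  have hL : IsSmoothForm (MForm.ofFun 𝓘(ℝ, ℂ) (logNorm u)) := isSmoothForm_ofFun_logNorm huC hu0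
  have hdΨ : IsSmoothForm (mextDeriv Ψ) := isSmoothForm_mextDeriv (inChart_mextDeriv_holds 𝓘(ℝ, ℂ) M ℂ) hΨ
  have hdL : IsSmoothForm (mextDeriv (MForm.ofFun 𝓘(ℝ, ℂ) (logNorm u))) :=
    isSmoothForm_mextDeriv (inChart_mextDeriv_holds 𝓘(ℝ, ℂ) M ℂ) hL
  have hκdL : IsSmoothForm ((2 * π * I)⁻¹ • mextDeriv (MForm.ofFun 𝓘(ℝ, ℂ) (logNorm u))) :=
    hdL.smul_complex _
  -- exactness of `θ ∧ dΨ` and of `θ ∧ κ d log|u|`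
  have hexact : ∀ {β : MForm 𝓘(ℝ, ℂ) M ℂ 1}, β ∈ cexactSmoothForms ℂ M 1 →
      (oneZeroForm ⇑(θ : MeromorphicOneForm M)).wedge β ∈ cexactSmoothForms ℂ M (1 + 1) := by
    intro β hβ
    rw [← Submodule.restrictScalars_mem ℝ, restrictScalars_cexactSmoothForms_holds (E := ℂ) (M := M)]
    refine wedge_mem_exactSmoothForms_of_right ⟨hs1, hθ.isClosedForm_oneZeroForm⟩ ?_
    rw [← restrictScalars_cexactSmoothForms_holds (E := ℂ) (M := M) 1]
    exact hβ
  have hexΨ : mextDeriv Ψ ∈ cexactSmoothForms ℂ M 1 := Submodule.subset_span ⟨Ψ, mem_csmoothForms hΨ, rfl⟩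
  have hexL : (2 * π * I)⁻¹ • mextDeriv (MForm.ofFun 𝓘(ℝ, ℂ) (logNorm u)) ∈ cexactSmoothForms ℂ M 1 :=
    Submodule.smul_mem _ _ (Submodule.subset_span ⟨_, mem_csmoothForms hL, rfl⟩)
  -- (i) via the chain form: `∬ θ ∧ β = ∬ θ ∧ σ_c = -(C/2) ∫_γ θ`
  have hI1 : cintegral (fun _ : M ↦ Complex.orientation)
      ((oneZeroForm ⇑(θ : MeromorphicOneForm M)).wedge (logDerivForm v)) =
      -(chartIntegralConst / 2 : ℝ) * period x₀ (θ : MeromorphicOneForm M) γ := by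
    have h := oneZeroForm_wedge_logDerivForm_unitize_closedChainUnit c hd0 hθ
    have h2 := cintegral_wedge_chainForm hper θ
    rw [← h, cintegral_add_of_isSmoothForm (IsSmoothFormWedge_holds 𝓘(ℝ, ℂ) M ℂ hs1 hsβ)
      (IsSmoothFormWedge_holds 𝓘(ℝ, ℂ) M ℂ hs1 hκdL), cintegral_eq_zero_of_mem_cexactSmoothForms (hexact hexL),
      add_zero] at h2
    exact h2
  -- (ii) via the Hodge decomposition: `∬ θ ∧ β = ∬ θ ∧ η̄ dz̄`
  have hI2 : cintegral (fun _ : M ↦ Complex.orientation)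
      ((oneZeroForm ⇑(θ : MeromorphicOneForm M)).wedge (logDerivForm v)) =
      holPairing (θ : MeromorphicOneForm M) (θ₂ : MeromorphicOneForm M) := by
    rw [hdec, h12, MForm.wedge_add_right, MForm.wedge_add_right, oneZeroForm_wedge_oneZeroForm, zero_add,
      cintegral_add_of_isSmoothForm (IsSmoothFormWedge_holds 𝓘(ℝ, ℂ) M ℂ hs1 hη.isSmoothForm_zeroOneForm_star)
        (IsSmoothFormWedge_holds 𝓘(ℝ, ℂ) M ℂ hs1 hdΨ),
      cintegral_eq_zero_of_mem_cexactSmoothForms (hexact hexΨ), add_zero, holPairing_def]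
  rw [← hI2, hI1]

end Loop

end RiemannSurface

end Literature.Geometry.Kaehler

end
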